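import Literature.Geometry.Lorentzian.CoordChristoffelDerivative
import HarnessLib

/-!
# The `C²`-perturbation estimate for the coordinate Ricci tensor

Two fields of metric components `G, G'` on one open set `V ⊆ E` (`MetricCoord.IsMetricOn`;
the two-metric calculus of `CoordMetricPair.lean`: `sharpAt_sub`, `riemAt_sub_eq`, `riemRem`).
With a common bound `N ≥ 1` for `‖♯‖, ‖♯'‖, ‖DG‖, ‖DG'‖, ‖D²G‖, ‖D²G'‖` at a point `x ∈ V` we bound
the difference of the Ricci forms at `x` **linearly in the `2`-jet of `G − G'` at `x`**:

* `IsMetricOn.fderiv_sharpAt_sub_eq`, `norm_fderiv_sharpAt_sub_le` — `D♯ − D♯'` and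
  `‖D♯(v) − D♯'(v)‖ ≤ N² (2‖♯ − ♯'‖ + ‖DG − DG'‖) ‖v‖`;
* `IsMetricOn.fderiv_chrAt_sub_apply_eq`, `norm_fderiv_chrAt_sub_apply_le` — `DΓ − DΓ'`
  (from `fderiv_chrAt_apply_eq`, `CoordChristoffelDerivative.lean`) and
  `‖(DΓ − DΓ')(v)(X)‖ ≤ (3/2) N³ (3‖♯−♯'‖ + 2‖DG−DG'‖ + ‖D²G−D²G'‖) ‖v‖ ‖X‖`;
* `opNorm_chrAt_sub_le`, `opNorm_chrAt_le` — `‖Γ − Γ'‖ ≤ (3/2) N (‖♯−♯'‖ + ‖DG−DG'‖)`, `‖Γ‖ ≤ 2N²`;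
* `IsMetricOn.norm_riemAt_sub_le` — `‖(R − R')(X,Y)Z‖ ≤ N³ (21‖♯−♯'‖ + 18‖DG−DG'‖ + 3‖D²G−D²G'‖) ‖X‖‖Y‖‖Z‖`;
* `IsMetricOn.abs_ricAt_sub_le` — **`|Ric(Y,Z) − Ric'(Y,Z)| ≤ 21 n N⁵ (‖G−G'‖ + ‖DG−DG'‖ + ‖D²G−D²G'‖) ‖Y‖ ‖Z‖`**
  at `x` (`n = dim E`, an inner product space; `‖♯ − ♯'‖ ≤ N² ‖G − G'‖`, `norm_sharpAt_sub_le`).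

This is the estimate by which the Ricci tensor of a `C²`-`ε`-neck is compared with that of the
model cylinder (R. Hamilton, Comm. Anal. Geom. 5 (1997), §C2; `CoordCylinderRicci.lean`,
`ImmersedChartRicci.lean`). Everything is proved; no definitions, no named facts.

## References

* B. Kotschwar, *An energy approach to the problem of uniqueness for the Ricci flow*,
  Comm. Anal. Geom. 22 (2014), §1.1 (5), (8). [Kotschwar2014]
* B. O'Neill, *Semi-Riemannian geometry*, Academic Press 1983, Ch. 3, Lemma 3.38, Lemma 3.52.
  [ONeill1983]
* R. S. Hamilton, *Four-manifolds with positive isotropic curvature*, Comm. Anal. Geom. 5 (1997),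
  §C2, p. 31. [Hamilton1997]
-/

noncomputable section

set_option maxSynthPendingDepth 3

open Set Filter ContinuousLinearMap Module
open scoped Topology ContDiff RealInnerProductSpace

namespace Literature.Geometry.Lorentzian

namespace MetricCoord

section Difference

variable {E : Type*} [NormedAddCommGroup E] [NormedSpace ℝ E] [CompleteSpace E]
  {G G' : E → E →L[ℝ] E →L[ℝ] ℝ} {V : Set E} {x : E}

/-- **`D♯ − D♯'`**: `D♯(v) − D♯'(v) = −[(♯−♯') ∘ DG(v) ∘ ♯ + ♯' ∘ (DG(v) − DG'(v)) ∘ ♯ + ♯' ∘ DG'(v) ∘ (♯−♯')]`.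
[cite: Kotschwar2014, §1.1 (5)] -/
theorem IsMetricOn.fderiv_sharpAt_sub_eq (hG : IsMetricOn G V) (hG' : IsMetricOn G' V)
    (hx : x ∈ V) (v : E) :
    fderiv ℝ (sharpAt G) x v - fderiv ℝ (sharpAt G') x v =
      -((sharpAt G x - sharpAt G' x).comp ((fderiv ℝ G x v).comp (sharpAt G x))
        + (sharpAt G' x).comp ((fderiv ℝ G x v - fderiv ℝ G' x v).comp (sharpAt G x))
        + (sharpAt G' x).comp ((fderiv ℝ G' x v).comp (sharpAt G x - sharpAt G' x))) := by
  rw [hG.fderiv_sharpAt hx v, hG'.fderiv_sharpAt hx v]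
  simp only [ContinuousLinearMap.sub_comp, ContinuousLinearMap.comp_sub]
  abel

/-- **`‖D♯(v) − D♯'(v)‖ ≤ N² (2‖♯−♯'‖ + ‖DG−DG'‖) ‖v‖`** for `‖♯‖, ‖♯'‖, ‖DG‖, ‖DG'‖ ≤ N`.
[cite: Kotschwar2014, §1.1 (5)] -/
theorem IsMetricOn.norm_fderiv_sharpAt_sub_le (hG : IsMetricOn G V) (hG' : IsMetricOn G' V)
    (hx : x ∈ V) {N : ℝ} (hs : ‖sharpAt G x‖ ≤ N) (hs' : ‖sharpAt G' x‖ ≤ N)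
    (h1 : ‖fderiv ℝ G x‖ ≤ N) (h1' : ‖fderiv ℝ G' x‖ ≤ N) (v : E) :
    ‖fderiv ℝ (sharpAt G) x v - fderiv ℝ (sharpAt G') x v‖ ≤
      N ^ 2 * (2 * ‖sharpAt G x - sharpAt G' x‖ + ‖fderiv ℝ G x - fderiv ℝ G' x‖) * ‖v‖ := by
  have hN0 : 0 ≤ N := (norm_nonneg _).trans hs
  set d₀ := ‖sharpAt G x - sharpAt G' x‖ with hd₀
  set d₁ := ‖fderiv ℝ G x - fderiv ℝ G' x‖ with hd₁
  rw [hG.fderiv_sharpAt_sub_eq hG' hx v, norm_neg]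
  have t1 : ‖(sharpAt G x - sharpAt G' x).comp ((fderiv ℝ G x v).comp (sharpAt G x))‖ ≤
      d₀ * (N * ‖v‖ * N) := by
    calc _ ≤ d₀ * ‖(fderiv ℝ G x v).comp (sharpAt G x)‖ := opNorm_comp_le _ _
      _ ≤ d₀ * (‖fderiv ℝ G x v‖ * ‖sharpAt G x‖) := by gcongr; exact opNorm_comp_le _ _
      _ ≤ d₀ * (‖fderiv ℝ G x‖ * ‖v‖ * ‖sharpAt G x‖) := by gcongr; exact le_opNorm _ _
      _ ≤ d₀ * (N * ‖v‖ * N) := by gcongr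
  have t2 : ‖(sharpAt G' x).comp ((fderiv ℝ G x v - fderiv ℝ G' x v).comp (sharpAt G x))‖ ≤
      N * (d₁ * ‖v‖ * N) := by
    calc _ ≤ ‖sharpAt G' x‖ * ‖(fderiv ℝ G x v - fderiv ℝ G' x v).comp (sharpAt G x)‖ :=
          opNorm_comp_le _ _
      _ ≤ ‖sharpAt G' x‖ * (‖fderiv ℝ G x v - fderiv ℝ G' x v‖ * ‖sharpAt G x‖) := by
          gcongr; exact opNorm_comp_le _ _
      _ ≤ ‖sharpAt G' x‖ * (d₁ * ‖v‖ * ‖sharpAt G x‖) := by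
          gcongr
          rw [← _root_.sub_apply]
          exact le_opNorm _ _
      _ ≤ N * (d₁ * ‖v‖ * N) := by gcongr
  have t3 : ‖(sharpAt G' x).comp ((fderiv ℝ G' x v).comp (sharpAt G x - sharpAt G' x))‖ ≤
      N * (N * ‖v‖ * d₀) := by
    calc _ ≤ ‖sharpAt G' x‖ * ‖(fderiv ℝ G' x v).comp (sharpAt G x - sharpAt G' x)‖ :=
          opNorm_comp_le _ _
      _ ≤ ‖sharpAt G' x‖ * (‖fderiv ℝ G' x v‖ * d₀) := by gcongr; exact opNorm_comp_le _ _
      _ ≤ ‖sharpAt G' x‖ * (‖fderiv ℝ G' x‖ * ‖v‖ * d₀) := by gcongr; exact le_opNorm _ _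
      _ ≤ N * (N * ‖v‖ * d₀) := by gcongr
  calc _ ≤ d₀ * (N * ‖v‖ * N) + N * (d₁ * ‖v‖ * N) + N * (N * ‖v‖ * d₀) :=
        norm_add_le_of_le (norm_add_le_of_le t1 t2) t3
    _ = N ^ 2 * (2 * d₀ + d₁) * ‖v‖ := by ring

/-- **`DΓ − DΓ'`**: `(DΓ − DΓ')(v)(X) = ½[(D♯−D♯')(v) ∘ K(X) + D♯'(v) ∘ (K−K')(X)
+ (♯−♯') ∘ koszulOp(D²G(v))(X) + ♯' ∘ koszulOp(D²G(v) − D²G'(v))(X)]`.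
[cite: Kotschwar2014, §1.1 (8)] -/
theorem IsMetricOn.fderiv_chrAt_sub_apply_eq (hG : IsMetricOn G V) (hG' : IsMetricOn G' V)
    (hx : x ∈ V) (v X : E) :
    fderiv ℝ (chrAt G) x v X - fderiv ℝ (chrAt G') x v X =
      (2⁻¹ : ℝ) • ((fderiv ℝ (sharpAt G) x v - fderiv ℝ (sharpAt G') x v).comp (koszulCLM G x X)
        + (fderiv ℝ (sharpAt G') x v).comp (koszulCLM G x X - koszulCLM G' x X)
        + (sharpAt G x - sharpAt G' x).comp (koszulOp (fderiv ℝ (fderiv ℝ G) x v) X)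
        + (sharpAt G' x).comp (koszulOp (fderiv ℝ (fderiv ℝ G) x v) X
            - koszulOp (fderiv ℝ (fderiv ℝ G') x v) X)) := by
  rw [hG.fderiv_chrAt_apply_eq hx v X, hG'.fderiv_chrAt_apply_eq hx v X, ← smul_sub]
  congr 1
  simp only [ContinuousLinearMap.sub_comp, ContinuousLinearMap.comp_sub]
  abel

omit [CompleteSpace E] in
/-- `‖koszulOp(D²G(v))(X) − koszulOp(D²G'(v))(X)‖ ≤ 3 ‖D²G − D²G'‖ ‖v‖ ‖X‖`. [folklore] -/
theorem norm_koszulOp_fderiv_fderiv_sub_apply_le (v X : E) :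
    ‖koszulOp (fderiv ℝ (fderiv ℝ G) x v) X - koszulOp (fderiv ℝ (fderiv ℝ G') x v) X‖ ≤
      3 * ‖fderiv ℝ (fderiv ℝ G) x - fderiv ℝ (fderiv ℝ G') x‖ * ‖v‖ * ‖X‖ := by
  have h : koszulOp (fderiv ℝ (fderiv ℝ G) x v) X - koszulOp (fderiv ℝ (fderiv ℝ G') x v) X =
      koszulOp ((fderiv ℝ (fderiv ℝ G) x - fderiv ℝ (fderiv ℝ G') x) v) X := by
    rw [_root_.sub_apply, map_sub, _root_.sub_apply]
  rw [h]
  calc _ ≤ 3 * ‖(fderiv ℝ (fderiv ℝ G) x - fderiv ℝ (fderiv ℝ G') x) v‖ * ‖X‖ :=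
        norm_koszulOp_apply_le _ X
    _ ≤ 3 * (‖fderiv ℝ (fderiv ℝ G) x - fderiv ℝ (fderiv ℝ G') x‖ * ‖v‖) * ‖X‖ := by
        gcongr; exact le_opNorm _ _
    _ = _ := by ring

/-- **`‖(DΓ − DΓ')(v)(X)‖ ≤ (3/2) N³ (3‖♯−♯'‖ + 2‖DG−DG'‖ + ‖D²G−D²G'‖) ‖v‖ ‖X‖`** for a common
bound `N ≥ 1` of `‖♯‖, ‖♯'‖, ‖DG‖, ‖DG'‖, ‖D²G‖`. [cite: Kotschwar2014, §1.1 (8)] -/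
theorem IsMetricOn.norm_fderiv_chrAt_sub_apply_le (hG : IsMetricOn G V) (hG' : IsMetricOn G' V)
    (hx : x ∈ V) {N : ℝ} (hN : 1 ≤ N) (hs : ‖sharpAt G x‖ ≤ N) (hs' : ‖sharpAt G' x‖ ≤ N)
    (h1 : ‖fderiv ℝ G x‖ ≤ N) (h1' : ‖fderiv ℝ G' x‖ ≤ N) (h2 : ‖fderiv ℝ (fderiv ℝ G) x‖ ≤ N)
    (v X : E) :
    ‖fderiv ℝ (chrAt G) x v X - fderiv ℝ (chrAt G') x v X‖ ≤
      2⁻¹ * 3 * N ^ 3 * (3 * ‖sharpAt G x - sharpAt G' x‖ + 2 * ‖fderiv ℝ G x - fderiv ℝ G' x‖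
        + ‖fderiv ℝ (fderiv ℝ G) x - fderiv ℝ (fderiv ℝ G') x‖) * ‖v‖ * ‖X‖ := by
  have hN0 : 0 ≤ N := zero_le_one.trans hN
  have hN3 : N ≤ N ^ 3 := by
    calc N = N ^ 1 := (pow_one N).symm
      _ ≤ N ^ 3 := pow_le_pow_right₀ hN (by norm_num)
  set d₀ := ‖sharpAt G x - sharpAt G' x‖ with hd₀
  set d₁ := ‖fderiv ℝ G x - fderiv ℝ G' x‖ with hd₁
  set d₂ := ‖fderiv ℝ (fderiv ℝ G) x - fderiv ℝ (fderiv ℝ G') x‖ with hd₂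
  have hd₀0 : 0 ≤ d₀ := norm_nonneg _
  have hd₁0 : 0 ≤ d₁ := norm_nonneg _
  have hd₂0 : 0 ≤ d₂ := norm_nonneg (fderiv ℝ (fderiv ℝ G) x - fderiv ℝ (fderiv ℝ G') x)
  rw [hG.fderiv_chrAt_sub_apply_eq hG' hx v X, norm_smul, Real.norm_eq_abs,
    abs_of_pos (by norm_num : (0 : ℝ) < 2⁻¹)]
  -- the four terms
  have hKX : ‖koszulCLM G x X‖ ≤ 3 * N * ‖X‖ :=
    (norm_koszulCLM_apply_le (G := G) X).trans (by gcongr)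
  have t1 : ‖(fderiv ℝ (sharpAt G) x v - fderiv ℝ (sharpAt G') x v).comp (koszulCLM G x X)‖ ≤
      N ^ 2 * (2 * d₀ + d₁) * ‖v‖ * (3 * N * ‖X‖) :=
    (opNorm_comp_le _ _).trans (mul_le_mul (hG.norm_fderiv_sharpAt_sub_le hG' hx hs hs' h1 h1' v)
      hKX (norm_nonneg _) (by positivity))
  have hDs' : ‖fderiv ℝ (sharpAt G') x v‖ ≤ N * N * N * ‖v‖ :=
    (hG'.norm_fderiv_sharpAt_apply_le hx v).trans (by gcongr)
  have t2 : ‖(fderiv ℝ (sharpAt G') x v).comp (koszulCLM G x X - koszulCLM G' x X)‖ ≤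
      N * N * N * ‖v‖ * (3 * d₁ * ‖X‖) :=
    (opNorm_comp_le _ _).trans (mul_le_mul hDs'
      (norm_koszulCLM_sub_apply_le (G := G) (G₀ := G') X) (norm_nonneg _) (by positivity))
  have t3 : ‖(sharpAt G x - sharpAt G' x).comp (koszulOp (fderiv ℝ (fderiv ℝ G) x v) X)‖ ≤
      d₀ * (3 * N * ‖v‖ * ‖X‖) :=
    (opNorm_comp_le _ _).trans (mul_le_mul_of_nonneg_left
      ((norm_koszulOp_fderiv_fderiv_apply_le v X).trans (by gcongr)) hd₀0)
  have t4 : ‖(sharpAt G' x).comp (koszulOp (fderiv ℝ (fderiv ℝ G) x v) X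
      - koszulOp (fderiv ℝ (fderiv ℝ G') x v) X)‖ ≤ N * (3 * d₂ * ‖v‖ * ‖X‖) :=
    (opNorm_comp_le _ _).trans (mul_le_mul hs' (norm_koszulOp_fderiv_fderiv_sub_apply_le v X)
      (norm_nonneg _) hN0)
  have hsum := norm_add_le_of_le (norm_add_le_of_le (norm_add_le_of_le t1 t2) t3) t4
  have hv0 : 0 ≤ ‖v‖ := norm_nonneg v
  have hX0 : 0 ≤ ‖X‖ := norm_nonneg X
  calc _ ≤ 2⁻¹ * (N ^ 2 * (2 * d₀ + d₁) * ‖v‖ * (3 * N * ‖X‖) + N * N * N * ‖v‖ * (3 * d₁ * ‖X‖)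
        + d₀ * (3 * N * ‖v‖ * ‖X‖) + N * (3 * d₂ * ‖v‖ * ‖X‖)) :=
          mul_le_mul_of_nonneg_left hsum (by norm_num)
    _ = 2⁻¹ * 3 * (N ^ 3 * (2 * d₀ + 2 * d₁) + N * (d₀ + d₂)) * ‖v‖ * ‖X‖ := by ring
    _ ≤ 2⁻¹ * 3 * (N ^ 3 * (2 * d₀ + 2 * d₁) + N ^ 3 * (d₀ + d₂)) * ‖v‖ * ‖X‖ := by gcongr
    _ = 2⁻¹ * 3 * N ^ 3 * (3 * d₀ + 2 * d₁ + d₂) * ‖v‖ * ‖X‖ := by ring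

omit [CompleteSpace E] in
/-- **`‖Γ − Γ'‖ ≤ (3/2) N (‖♯ − ♯'‖ + ‖DG − DG'‖)`** (operator norm of the connection difference
`A = Γ − Γ'` at `x`) for `‖♯'‖, ‖DG‖ ≤ N`. [cite: Kotschwar2014, §1.1 (7)] -/
theorem opNorm_chrAt_sub_le {N : ℝ} (hs' : ‖sharpAt G' x‖ ≤ N) (h1 : ‖fderiv ℝ G x‖ ≤ N) :
    ‖chrAt G x - chrAt G' x‖ ≤
      2⁻¹ * 3 * N * (‖sharpAt G x - sharpAt G' x‖ + ‖fderiv ℝ G x - fderiv ℝ G' x‖) := by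
  have hN0 : 0 ≤ N := (norm_nonneg _).trans hs'
  refine opNorm_le_bound _ (by positivity) fun X ↦ ?_
  rw [_root_.sub_apply]
  calc ‖chrAt G x X - chrAt G' x X‖
      ≤ 2⁻¹ * (3 * (‖sharpAt G x - sharpAt G' x‖ * ‖fderiv ℝ G x‖
          + ‖sharpAt G' x‖ * ‖fderiv ℝ G x - fderiv ℝ G' x‖) * ‖X‖) :=
        norm_chrAt_sub_chrAt_apply_le X
    _ ≤ 2⁻¹ * (3 * (‖sharpAt G x - sharpAt G' x‖ * N
          + N * ‖fderiv ℝ G x - fderiv ℝ G' x‖) * ‖X‖) := by gcongr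
    _ = _ := by ring

omit [CompleteSpace E] in
/-- **`‖Γ‖ ≤ 2 N²`** for `‖♯‖, ‖DG‖ ≤ N` (indeed `(3/2) N²`). [folklore] -/
theorem opNorm_chrAt_le {N : ℝ} (hs : ‖sharpAt G x‖ ≤ N) (h1 : ‖fderiv ℝ G x‖ ≤ N) :
    ‖chrAt G x‖ ≤ 2 * N ^ 2 := by
  have hN0 : 0 ≤ N := (norm_nonneg _).trans hs
  refine opNorm_le_bound _ (by positivity) fun X ↦ ?_
  calc ‖chrAt G x X‖ ≤ 2⁻¹ * (‖sharpAt G x‖ * (3 * ‖fderiv ℝ G x‖ * ‖X‖)) := norm_chrAt_apply_le X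
    _ ≤ 2⁻¹ * (N * (3 * N * ‖X‖)) := by gcongr
    _ ≤ 2 * N ^ 2 * ‖X‖ := by nlinarith [norm_nonneg X, sq_nonneg N]

/-- **`‖(R − R')(X,Y)Z‖ ≤ N³ (21‖♯−♯'‖ + 18‖DG−DG'‖ + 3‖D²G−D²G'‖) ‖X‖ ‖Y‖ ‖Z‖`** for a common
bound `N ≥ 1` of `‖♯‖, ‖♯'‖, ‖DG‖, ‖DG'‖, ‖D²G‖` (`R − R' = DA − DA + riemRem`, `riemAt_sub_eq`,
`norm_riemRem_le`). [cite: Kotschwar2014, §1.1 (8)] -/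
theorem IsMetricOn.norm_riemAt_sub_le (hG : IsMetricOn G V) (hG' : IsMetricOn G' V)
    (hx : x ∈ V) {N : ℝ} (hN : 1 ≤ N) (hs : ‖sharpAt G x‖ ≤ N) (hs' : ‖sharpAt G' x‖ ≤ N)
    (h1 : ‖fderiv ℝ G x‖ ≤ N) (h1' : ‖fderiv ℝ G' x‖ ≤ N) (h2 : ‖fderiv ℝ (fderiv ℝ G) x‖ ≤ N)
    (X Y Z : E) :
    ‖riemAt G x X Y Z - riemAt G' x X Y Z‖ ≤
      N ^ 3 * (21 * ‖sharpAt G x - sharpAt G' x‖ + 18 * ‖fderiv ℝ G x - fderiv ℝ G' x‖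
        + 3 * ‖fderiv ℝ (fderiv ℝ G) x - fderiv ℝ (fderiv ℝ G') x‖) * ‖X‖ * ‖Y‖ * ‖Z‖ := by
  have hN0 : 0 ≤ N := zero_le_one.trans hN
  have hN13 : N ≤ N ^ 3 := by
    calc N = N ^ 1 := (pow_one N).symm
      _ ≤ N ^ 3 := pow_le_pow_right₀ hN (by norm_num)
  set d₀ := ‖sharpAt G x - sharpAt G' x‖ with hd₀
  set d₁ := ‖fderiv ℝ G x - fderiv ℝ G' x‖ with hd₁
  set d₂ := ‖fderiv ℝ (fderiv ℝ G) x - fderiv ℝ (fderiv ℝ G') x‖ with hd₂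
  have hd₀0 : 0 ≤ d₀ := norm_nonneg _
  have hd₁0 : 0 ≤ d₁ := norm_nonneg _
  have hd₂0 : 0 ≤ d₂ := norm_nonneg (fderiv ℝ (fderiv ℝ G) x - fderiv ℝ (fderiv ℝ G') x)
  set C := 2⁻¹ * 3 * N ^ 3 * (3 * d₀ + 2 * d₁ + d₂) with hC
  have hC0 : 0 ≤ C := by positivity
  -- the `DA` terms
  have hDA : ∀ U W : E, ‖(fderiv ℝ (chrAt G) x - fderiv ℝ (chrAt G') x) U W Z‖ ≤
      C * ‖U‖ * ‖W‖ * ‖Z‖ := by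
    intro U W
    have h := hG.norm_fderiv_chrAt_sub_apply_le hG' hx hN hs hs' h1 h1' h2 U W
    calc ‖(fderiv ℝ (chrAt G) x - fderiv ℝ (chrAt G') x) U W Z‖
        = ‖(fderiv ℝ (chrAt G) x U W - fderiv ℝ (chrAt G') x U W) Z‖ := by
            simp only [_root_.sub_apply]
      _ ≤ ‖fderiv ℝ (chrAt G) x U W - fderiv ℝ (chrAt G') x U W‖ * ‖Z‖ := le_opNorm _ _
      _ ≤ C * ‖U‖ * ‖W‖ * ‖Z‖ := by rw [hC]; gcongr
  -- the `A` terms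
  have hΓ : ‖chrAt G x‖ ≤ 2 * N ^ 2 := opNorm_chrAt_le hs h1
  have hΓ' : ‖chrAt G' x‖ ≤ 2 * N ^ 2 := opNorm_chrAt_le hs' h1'
  have hA : ‖chrDiff G G' x‖ ≤ 2⁻¹ * 3 * N * (d₀ + d₁) := by
    rw [chrDiff_apply]; exact opNorm_chrAt_sub_le hs' h1
  have hrem := norm_riemRem_le (G := G) (G' := G') (x := x) hΓ hΓ' X Y Z
  have hrem' : ‖riemRem G G' x X Y Z‖ ≤ 4 * (2 * N ^ 2) * (2⁻¹ * 3 * N * (d₀ + d₁)) * ‖X‖ * ‖Y‖ * ‖Z‖ :=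
    hrem.trans (by gcongr)
  rw [riemAt_sub_eq]
  calc _ ≤ C * ‖X‖ * ‖Y‖ * ‖Z‖ + C * ‖Y‖ * ‖X‖ * ‖Z‖
        + 4 * (2 * N ^ 2) * (2⁻¹ * 3 * N * (d₀ + d₁)) * ‖X‖ * ‖Y‖ * ‖Z‖ :=
          norm_add_le_of_le (norm_sub_le_of_le (hDA X Y) (hDA Y X)) hrem'
    _ = N ^ 3 * (21 * d₀ + 18 * d₁ + 3 * d₂) * ‖X‖ * ‖Y‖ * ‖Z‖ := by rw [hC]; ring

end Difference

/-! ### The Ricci difference -/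

section Ricci

variable {E : Type*} [NormedAddCommGroup E] [InnerProductSpace ℝ E] [FiniteDimensional ℝ E]
  [CompleteSpace E] {G G' : E → E →L[ℝ] E →L[ℝ] ℝ} {V : Set E} {x : E}

/-- **The `C²`-perturbation estimate for the Ricci form**: for two fields of metric components
on `V ∋ x` with `‖♯‖, ‖♯'‖, ‖DG‖, ‖DG'‖, ‖D²G‖ ≤ N` at `x` (`N ≥ 1`),
`|Ric(Y,Z) − Ric'(Y,Z)| ≤ 21 n N⁵ (‖G−G'‖ + ‖DG−DG'‖ + ‖D²G−D²G'‖) ‖Y‖ ‖Z‖` at `x`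
(`n = dim E`): the Ricci tensor is Lipschitz in the `2`-jet of the metric components on sets of
uniformly nondegenerate, `C²`-bounded components. [cite: Kotschwar2014, §1.1 (5)–(8)] -/
theorem IsMetricOn.abs_ricAt_sub_le (hG : IsMetricOn G V) (hG' : IsMetricOn G' V) (hx : x ∈ V)
    {N : ℝ} (hN : 1 ≤ N) (hs : ‖sharpAt G x‖ ≤ N) (hs' : ‖sharpAt G' x‖ ≤ N)
    (h1 : ‖fderiv ℝ G x‖ ≤ N) (h1' : ‖fderiv ℝ G' x‖ ≤ N) (h2 : ‖fderiv ℝ (fderiv ℝ G) x‖ ≤ N)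
    (Y Z : E) :
    |ricAt G x Y Z - ricAt G' x Y Z| ≤ 21 * Module.finrank ℝ E * N ^ 5 *
      (‖G x - G' x‖ + ‖fderiv ℝ G x - fderiv ℝ G' x‖
        + ‖fderiv ℝ (fderiv ℝ G) x - fderiv ℝ (fderiv ℝ G') x‖) * ‖Y‖ * ‖Z‖ := by
  have hN0 : 0 ≤ N := zero_le_one.trans hN
  set b := stdOrthonormalBasis ℝ E with hb
  set d₀ := ‖sharpAt G x - sharpAt G' x‖ with hd₀
  set dH := ‖G x - G' x‖ with hdH
  set d₁ := ‖fderiv ℝ G x - fderiv ℝ G' x‖ with hd₁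
  set d₂ := ‖fderiv ℝ (fderiv ℝ G) x - fderiv ℝ (fderiv ℝ G') x‖ with hd₂
  have hd₁0 : 0 ≤ d₁ := norm_nonneg _
  have hd₂0 : 0 ≤ d₂ := norm_nonneg (fderiv ℝ (fderiv ℝ G) x - fderiv ℝ (fderiv ℝ G') x)
  have hdH0 : 0 ≤ dH := norm_nonneg _
  -- `‖♯ − ♯'‖ ≤ N² ‖G − G'‖`
  have hd₀ : d₀ ≤ N ^ 2 * dH := by
    calc d₀ ≤ ‖sharpAt G x‖ * ‖G x - G' x‖ * ‖sharpAt G' x‖ :=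
          norm_sharpAt_sub_le (hG.isInvertible x hx) (hG'.isInvertible x hx)
      _ ≤ N * dH * N := by gcongr
      _ = N ^ 2 * dH := by ring
  -- termwise
  have hsub : ricAt G x Y Z - ricAt G' x Y Z =
      ∑ i, ⟪b i, riemAt G x (b i) Y Z - riemAt G' x (b i) Y Z⟫ := by
    rw [ricAt_eq_sum_inner b, ricAt_eq_sum_inner b, ← Finset.sum_sub_distrib]
    refine Finset.sum_congr rfl fun i _ ↦ ?_
    rw [inner_sub_right]
  have hterm : ∀ i, |⟪b i, riemAt G x (b i) Y Z - riemAt G' x (b i) Y Z⟫| ≤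
      N ^ 3 * (21 * d₀ + 18 * d₁ + 3 * d₂) * ‖Y‖ * ‖Z‖ := by
    intro i
    have ha := abs_real_inner_le_norm (b i) (riemAt G x (b i) Y Z - riemAt G' x (b i) Y Z)
    rw [b.orthonormal.1 i, one_mul] at ha
    have hb' := hG.norm_riemAt_sub_le hG' hx hN hs hs' h1 h1' h2 (b i) Y Z
    rw [b.orthonormal.1 i, mul_one] at hb'
    exact ha.trans hb'
  rw [hsub]
  calc |∑ i, ⟪b i, riemAt G x (b i) Y Z - riemAt G' x (b i) Y Z⟫|
      ≤ ∑ i, |⟪b i, riemAt G x (b i) Y Z - riemAt G' x (b i) Y Z⟫| := Finset.abs_sum_le_sum_abs _ _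
    _ ≤ ∑ _i : Fin (Module.finrank ℝ E), N ^ 3 * (21 * d₀ + 18 * d₁ + 3 * d₂) * ‖Y‖ * ‖Z‖ :=
        Finset.sum_le_sum fun i _ ↦ hterm i
    _ = Module.finrank ℝ E * (N ^ 3 * (21 * d₀ + 18 * d₁ + 3 * d₂) * ‖Y‖ * ‖Z‖) := by
        rw [Finset.sum_const, Finset.card_univ, Fintype.card_fin, nsmul_eq_mul]
    _ ≤ Module.finrank ℝ E * (N ^ 3 * (21 * (N ^ 2 * dH) + 18 * (N ^ 2 * d₁) + 3 * (N ^ 2 * d₂))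
        * ‖Y‖ * ‖Z‖) := by
        have hN2 : (1 : ℝ) ≤ N ^ 2 := one_le_pow₀ hN
        have e1 : d₁ ≤ N ^ 2 * d₁ := le_mul_of_one_le_left hd₁0 hN2
        have e2 : d₂ ≤ N ^ 2 * d₂ := le_mul_of_one_le_left hd₂0 hN2
        gcongr
    _ ≤ 21 * Module.finrank ℝ E * N ^ 5 * (dH + d₁ + d₂) * ‖Y‖ * ‖Z‖ := by
        have hn0 : (0 : ℝ) ≤ Module.finrank ℝ E := Nat.cast_nonneg _
        have hY0 := norm_nonneg Y
        have hZ0 := norm_nonneg Z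
        have key : N ^ 3 * (21 * (N ^ 2 * dH) + 18 * (N ^ 2 * d₁) + 3 * (N ^ 2 * d₂)) ≤
            21 * N ^ 5 * (dH + d₁ + d₂) := by
          nlinarith [pow_nonneg hN0 5, mul_nonneg (pow_nonneg hN0 5) hd₁0,
            mul_nonneg (pow_nonneg hN0 5) hd₂0]
        calc _ ≤ Module.finrank ℝ E * (21 * N ^ 5 * (dH + d₁ + d₂) * ‖Y‖ * ‖Z‖) := by gcongr
          _ = _ := by ring

end Ricci

end MetricCoord

end Literature.Geometry.Lorentzian

end


/-! ### Convergence of `♯`, `g^{ij}`, `R` and of the trace invariants along converging `2`-jets (appended 2026-08-16)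

A filter version of the `C²`-Lipschitz estimate `IsMetricOn.norm_riemAt_sub_le`: two fields of
metric components `G` (a chart metric) and `G₀` (a stationary reference) and points `x n` along a
filter `l` such that `G`, `G₀` are metric components on open sets `V n ∋ x n`, the `2`-jet and the
curvature of `G₀` at `x n` are those at a fixed point `x₀`, and the `2`-jets of `G − G₀` at `x n`
tend to `0` (in norm). Then at `x n` the index-raising map (`tendsto_sharpAt_of_jets`), the inverse
metric coefficients (`tendsto_ginv_of_jets`), the curvature endomorphisms (`tendsto_riemAt_of_jets`)
and the quadratic and cubic trace invariants (`tendsto_quadTrace_of_jets`,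
`tendsto_cubicTrace_of_jets`) of `G` converge to those of `G₀` at `x₀`. Everything is proved; no
definition. -/

noncomputable section

namespace Literature.Geometry.Lorentzian

namespace MetricCoord

section JetConvergence

set_option maxSynthPendingDepth 3

open Set Filter ContinuousLinearMap Module Topology

variable {E : Type*} [NormedAddCommGroup E] [NormedSpace ℝ E] [FiniteDimensional ℝ E]
  [CompleteSpace E]

omit [FiniteDimensional ℝ E] [CompleteSpace E] in
/-- Composition of continuous linear maps is jointly continuous: limits compose. [folklore] -/
theorem tendsto_clm_comp {α : Type*} {l : Filter α} {A : α → E →L[ℝ] E} {B : α → E →L[ℝ] E}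
    {A₀ B₀ : E →L[ℝ] E} (hA : Tendsto A l (𝓝 A₀)) (hB : Tendsto B l (𝓝 B₀)) :
    Tendsto (fun n ↦ (A n).comp (B n)) l (𝓝 (A₀.comp B₀)) := by
  have hc : Continuous fun p : (E →L[ℝ] E) × (E →L[ℝ] E) ↦ p.1.comp p.2 :=
    isBoundedBilinearMap_comp.continuous
  exact (hc.tendsto (A₀, B₀)).comp (hA.prodMk_nhds hB)

section Jets

variable {α : Type*} {l : Filter α} {G G₀ : E → E →L[ℝ] E →L[ℝ] ℝ} {V : α → Set E}
  {x : α → E} {x₀ : E}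

omit [FiniteDimensional ℝ E] [CompleteSpace E] in
/-- **`♯` converges**: if `G₀ (x n) = G₀ x₀` and `‖G (x n) − G₀ (x n)‖ → 0` with all forms
invertible, then `‖♯_G(x n) − ♯_{G₀}(x₀)‖ → 0` (`‖♯ − ♯₀‖ ≤ ‖♯‖ ‖G − G₀‖ ‖♯₀‖` and `‖♯‖ ≤ 2‖♯₀‖`
for small perturbations). [cite: Kotschwar2014, §1.1 (5)] -/
theorem tendsto_sharpAt_of_jets (hG : ∀ n, IsMetricOn G (V n)) (hG₀ : ∀ n, IsMetricOn G₀ (V n))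
    (hx : ∀ n, x n ∈ V n) (h0 : ∀ n, G₀ (x n) = G₀ x₀)
    (hd0 : Tendsto (fun n ↦ ‖G (x n) - G₀ (x n)‖) l (𝓝 0)) :
    Tendsto (fun n ↦ ‖sharpAt G (x n) - sharpAt G₀ x₀‖) l (𝓝 0) := by
  have hs0 : ∀ n, sharpAt G₀ (x n) = sharpAt G₀ x₀ := fun n ↦ by
    show (G₀ (x n)).inverse = (G₀ x₀).inverse
    rw [h0 n]
  have hS0 : 0 ≤ ‖sharpAt G₀ x₀‖ := norm_nonneg (sharpAt G₀ x₀)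
  -- eventually the perturbation is small: `S ‖G − G₀‖ ≤ ½`
  have hsmall : ∀ᶠ n in l, ‖sharpAt G₀ x₀‖ * ‖G (x n) - G₀ (x n)‖ ≤ 2⁻¹ := by
    have h := hd0.const_mul ‖sharpAt G₀ x₀‖
    rw [mul_zero] at h
    exact h.eventually_le_const (by norm_num : (0 : ℝ) < 2⁻¹)
  -- the basic estimate `‖♯ − ♯₀‖ ≤ ‖♯‖ ‖G − G₀‖ ‖♯₀‖` at `x n`
  have hest : ∀ n, ‖sharpAt G (x n) - sharpAt G₀ x₀‖ ≤
      ‖sharpAt G (x n)‖ * ‖G (x n) - G₀ (x n)‖ * ‖sharpAt G₀ x₀‖ := fun n ↦ by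
    have h := norm_sharpAt_sub_le ((hG n).isInvertible _ (hx n)) ((hG₀ n).isInvertible _ (hx n))
    rw [hs0 n] at h
    exact h
  -- hence `‖♯(x n)‖ ≤ 2 S` eventually
  have hbound : ∀ᶠ n in l, ‖sharpAt G (x n)‖ ≤ 2 * ‖sharpAt G₀ x₀‖ := by
    filter_upwards [hsmall] with n hn
    have h1 : ‖sharpAt G (x n)‖ ≤ ‖sharpAt G₀ x₀‖ + ‖sharpAt G (x n) - sharpAt G₀ x₀‖ := by
      have h := norm_add_le (sharpAt G₀ x₀) (sharpAt G (x n) - sharpAt G₀ x₀)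
      rwa [add_sub_cancel] at h
    have h2 : ‖sharpAt G (x n) - sharpAt G₀ x₀‖ ≤ 2⁻¹ * ‖sharpAt G (x n)‖ := by
      calc ‖sharpAt G (x n) - sharpAt G₀ x₀‖
          ≤ ‖sharpAt G (x n)‖ * ‖G (x n) - G₀ (x n)‖ * ‖sharpAt G₀ x₀‖ := hest n
        _ = ‖sharpAt G (x n)‖ * (‖sharpAt G₀ x₀‖ * ‖G (x n) - G₀ (x n)‖) := by ring
        _ ≤ ‖sharpAt G (x n)‖ * 2⁻¹ := by gcongr
        _ = 2⁻¹ * ‖sharpAt G (x n)‖ := by ring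
    linarith
  refine squeeze_zero' (Eventually.of_forall fun n ↦ norm_nonneg _) ?_
    (?_ : Tendsto (fun n ↦ 2 * ‖sharpAt G₀ x₀‖ * ‖G (x n) - G₀ (x n)‖ * ‖sharpAt G₀ x₀‖) l (𝓝 0))
  · filter_upwards [hbound] with n hn
    calc ‖sharpAt G (x n) - sharpAt G₀ x₀‖
        ≤ ‖sharpAt G (x n)‖ * ‖G (x n) - G₀ (x n)‖ * ‖sharpAt G₀ x₀‖ := hest n
      _ ≤ 2 * ‖sharpAt G₀ x₀‖ * ‖G (x n) - G₀ (x n)‖ * ‖sharpAt G₀ x₀‖ := by gcongr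
  · have h := (hd0.const_mul (2 * ‖sharpAt G₀ x₀‖)).mul_const ‖sharpAt G₀ x₀‖
    rw [mul_zero, zero_mul] at h
    exact h

omit [CompleteSpace E] in
/-- **The inverse metric coefficients converge** (`g^{ij} = bⁱ(♯ bʲ)`). [cite: Kotschwar2014, §1.1 (5)] -/
theorem tendsto_ginv_of_jets {ι : Type*} [Fintype ι] (b : Module.Basis ι ℝ E)
    (hG : ∀ n, IsMetricOn G (V n)) (hG₀ : ∀ n, IsMetricOn G₀ (V n))
    (hx : ∀ n, x n ∈ V n) (h0 : ∀ n, G₀ (x n) = G₀ x₀)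
    (hd0 : Tendsto (fun n ↦ ‖G (x n) - G₀ (x n)‖) l (𝓝 0)) (i j : ι) :
    Tendsto (fun n ↦ ginv G b (x n) i j) l (𝓝 (ginv G₀ b x₀ i j)) := by
  have hs := tendsto_sharpAt_of_jets hG hG₀ hx h0 hd0
  rw [Metric.tendsto_nhds]
  intro ε hε
  have hC : 0 < ‖coordCLM b i‖ * ‖coordCLM b j‖ + 1 := by positivity
  filter_upwards [(Metric.tendsto_nhds.mp hs) (ε / (‖coordCLM b i‖ * ‖coordCLM b j‖ + 1))
    (by positivity)] with n hn
  rw [Real.dist_eq, sub_zero, abs_of_nonneg (norm_nonneg (sharpAt G (x n) - sharpAt G₀ x₀))] at hn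
  rw [Real.dist_eq]
  have hsub : ginv G b (x n) i j - ginv G₀ b x₀ i j =
      coordCLM b i ((sharpAt G (x n) - sharpAt G₀ x₀) (coordCLM b j)) := by
    simp only [ginv, _root_.sub_apply, map_sub, coordCLM_apply]
  rw [hsub]
  calc |coordCLM b i ((sharpAt G (x n) - sharpAt G₀ x₀) (coordCLM b j))|
      = ‖coordCLM b i ((sharpAt G (x n) - sharpAt G₀ x₀) (coordCLM b j))‖ := (Real.norm_eq_abs _).symm
    _ ≤ ‖coordCLM b i‖ * ‖(sharpAt G (x n) - sharpAt G₀ x₀) (coordCLM b j)‖ := le_opNorm _ _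
    _ ≤ ‖coordCLM b i‖ * (‖sharpAt G (x n) - sharpAt G₀ x₀‖ * ‖coordCLM b j‖) := by
        gcongr; exact le_opNorm _ _
    _ = (‖coordCLM b i‖ * ‖coordCLM b j‖) * ‖sharpAt G (x n) - sharpAt G₀ x₀‖ := by ring
    _ ≤ (‖coordCLM b i‖ * ‖coordCLM b j‖ + 1) * ‖sharpAt G (x n) - sharpAt G₀ x₀‖ := by
        gcongr; linarith
    _ < (‖coordCLM b i‖ * ‖coordCLM b j‖ + 1) * (ε / (‖coordCLM b i‖ * ‖coordCLM b j‖ + 1)) := by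
        gcongr
    _ = ε := by field_simp

omit [FiniteDimensional ℝ E] in
set_option maxHeartbeats 800000 in
/-- **The curvature endomorphisms converge**: with stationary reference jets and curvature
(`G₀`, `DG₀`, `D²G₀`, `R₀` at `x n` equal to their values at `x₀`) and `2`-jets of `G − G₀` at
`x n` tending to `0`, `R^G_{x n}(X, Y) → R^{G₀}_{x₀}(X, Y)` in operator norm
(`IsMetricOn.norm_riemAt_sub_le` with an eventually uniform constant). [cite: Kotschwar2014, §1.1 (8)] -/
theorem tendsto_riemAt_of_jets (hG : ∀ n, IsMetricOn G (V n)) (hG₀ : ∀ n, IsMetricOn G₀ (V n))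
    (hx : ∀ n, x n ∈ V n) (h0 : ∀ n, G₀ (x n) = G₀ x₀)
    (h1 : ∀ n, fderiv ℝ G₀ (x n) = fderiv ℝ G₀ x₀)
    (h2 : ∀ n, fderiv ℝ (fderiv ℝ G₀) (x n) = fderiv ℝ (fderiv ℝ G₀) x₀)
    (hR : ∀ n (X Y : E), riemAt G₀ (x n) X Y = riemAt G₀ x₀ X Y)
    (hd0 : Tendsto (fun n ↦ ‖G (x n) - G₀ (x n)‖) l (𝓝 0))
    (hd1 : Tendsto (fun n ↦ ‖fderiv ℝ G (x n) - fderiv ℝ G₀ (x n)‖) l (𝓝 0))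
    (hd2 : Tendsto (fun n ↦ ‖fderiv ℝ (fderiv ℝ G) (x n) - fderiv ℝ (fderiv ℝ G₀) (x n)‖) l (𝓝 0))
    (X Y : E) :
    Tendsto (fun n ↦ riemAt G (x n) X Y) l (𝓝 (riemAt G₀ x₀ X Y)) := by
  have hs0 : ∀ n, sharpAt G₀ (x n) = sharpAt G₀ x₀ := fun n ↦ by
    show (G₀ (x n)).inverse = (G₀ x₀).inverse
    rw [h0 n]
  -- the constant
  have hS0 : 0 ≤ ‖sharpAt G₀ x₀‖ := norm_nonneg (sharpAt G₀ x₀)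
  have hA0 : 0 ≤ ‖fderiv ℝ G₀ x₀‖ := norm_nonneg _
  have hB0 : 0 ≤ ‖fderiv ℝ (fderiv ℝ G₀) x₀‖ := norm_nonneg (fderiv ℝ (fderiv ℝ G₀) x₀)
  obtain ⟨N, hN1, hNS, hNA, hNB⟩ : ∃ N : ℝ, 1 ≤ N ∧ 2 * ‖sharpAt G₀ x₀‖ + 1 ≤ N ∧
      ‖fderiv ℝ G₀ x₀‖ + 1 ≤ N ∧ ‖fderiv ℝ (fderiv ℝ G₀) x₀‖ + 1 ≤ N :=
    ⟨1 + 2 * ‖sharpAt G₀ x₀‖ + (‖fderiv ℝ G₀ x₀‖ + 1) + (‖fderiv ℝ (fderiv ℝ G₀) x₀‖ + 1),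
      by linarith, by linarith, by linarith, by linarith⟩
  have hN0 : 0 ≤ N := zero_le_one.trans hN1
  -- the sharp maps converge
  have hsn : Tendsto (fun n ↦ ‖sharpAt G (x n) - sharpAt G₀ (x n)‖) l (𝓝 0) := by
    have h := tendsto_sharpAt_of_jets hG hG₀ hx h0 hd0
    refine h.congr fun n ↦ ?_
    rw [hs0 n]
  -- eventual uniform bounds by `N`
  have ev_s : ∀ᶠ n in l, ‖sharpAt G (x n)‖ ≤ N := by
    filter_upwards [hsn.eventually_le_const (show (0 : ℝ) < 1 by norm_num)] with n hn
    have h3 := norm_sub_norm_le (sharpAt G (x n)) (sharpAt G₀ (x n))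
    have h4 : ‖sharpAt G₀ (x n)‖ = ‖sharpAt G₀ x₀‖ := by rw [hs0 n]
    linarith
  have ev_1 : ∀ᶠ n in l, ‖fderiv ℝ G (x n)‖ ≤ N := by
    filter_upwards [hd1.eventually_le_const (show (0 : ℝ) < 1 by norm_num)] with n hn
    have h3 := norm_sub_norm_le (fderiv ℝ G (x n)) (fderiv ℝ G₀ (x n))
    have h4 : ‖fderiv ℝ G₀ (x n)‖ = ‖fderiv ℝ G₀ x₀‖ := by rw [h1 n]
    linarith
  have ev_2 : ∀ᶠ n in l, ‖fderiv ℝ (fderiv ℝ G) (x n)‖ ≤ N := by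
    filter_upwards [hd2.eventually_le_const (show (0 : ℝ) < 1 by norm_num)] with n hn
    have h3 := norm_sub_norm_le (fderiv ℝ (fderiv ℝ G) (x n)) (fderiv ℝ (fderiv ℝ G₀) (x n))
    have h4 : ‖fderiv ℝ (fderiv ℝ G₀) (x n)‖ = ‖fderiv ℝ (fderiv ℝ G₀) x₀‖ := by rw [h2 n]
    linarith
  have hs' : ∀ n, ‖sharpAt G₀ (x n)‖ ≤ N := fun n ↦ by rw [hs0 n]; linarith
  have h1' : ∀ n, ‖fderiv ℝ G₀ (x n)‖ ≤ N := fun n ↦ by rw [h1 n]; linarith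
  -- the Lipschitz estimate, eventually
  have ha0 : Tendsto (fun n ↦ N ^ 3 * (21 * ‖sharpAt G (x n) - sharpAt G₀ (x n)‖
      + 18 * ‖fderiv ℝ G (x n) - fderiv ℝ G₀ (x n)‖
      + 3 * ‖fderiv ℝ (fderiv ℝ G) (x n) - fderiv ℝ (fderiv ℝ G₀) (x n)‖) * ‖X‖ * ‖Y‖) l
      (𝓝 0) := by
    have e1 := ((hsn.const_mul 21).add (hd1.const_mul 18)).add (hd2.const_mul 3)
    rw [mul_zero, mul_zero, mul_zero, add_zero, add_zero] at e1
    have e2 := ((e1.const_mul (N ^ 3)).mul_const ‖X‖).mul_const ‖Y‖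
    rw [mul_zero, zero_mul, zero_mul] at e2
    exact e2
  have hev : ∀ᶠ n in l, ‖riemAt G (x n) X Y - riemAt G₀ x₀ X Y‖ ≤
      N ^ 3 * (21 * ‖sharpAt G (x n) - sharpAt G₀ (x n)‖
      + 18 * ‖fderiv ℝ G (x n) - fderiv ℝ G₀ (x n)‖
      + 3 * ‖fderiv ℝ (fderiv ℝ G) (x n) - fderiv ℝ (fderiv ℝ G₀) (x n)‖) * ‖X‖ * ‖Y‖ := by
    filter_upwards [ev_s, ev_1, ev_2] with n hns hn1 hn2
    rw [← hR n X Y]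
    have hds0 : 0 ≤ ‖sharpAt G (x n) - sharpAt G₀ (x n)‖ := norm_nonneg _
    have hd10 : 0 ≤ ‖fderiv ℝ G (x n) - fderiv ℝ G₀ (x n)‖ := norm_nonneg _
    have hd20 : 0 ≤ ‖fderiv ℝ (fderiv ℝ G) (x n) - fderiv ℝ (fderiv ℝ G₀) (x n)‖ :=
      norm_nonneg (fderiv ℝ (fderiv ℝ G) (x n) - fderiv ℝ (fderiv ℝ G₀) (x n))
    refine ContinuousLinearMap.opNorm_le_bound _ (by positivity) fun Z ↦ ?_
    rw [_root_.sub_apply]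
    exact (hG n).norm_riemAt_sub_le (hG₀ n) (hx n) hN1 hns (hs' n) hn1 (h1' n) hn2 X Y Z
  exact tendsto_sub_nhds_zero_iff.mp (squeeze_zero_norm' hev ha0)

variable {ι : Type*} [Fintype ι] (b : Module.Basis ι ℝ E)

/-- **The quadratic trace invariant converges** along the points `x n`:
`Σ g^{aa'}g^{cc'} tr(R(b_a,b_c) R(b_{a'},b_{c'}))` of `G` at `x n` tends to that of `G₀` at `x₀`.
[cite: Kotschwar2014, §1.1 (8)] -/
theorem tendsto_quadTrace_of_jets (hG : ∀ n, IsMetricOn G (V n)) (hG₀ : ∀ n, IsMetricOn G₀ (V n))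
    (hx : ∀ n, x n ∈ V n) (h0 : ∀ n, G₀ (x n) = G₀ x₀)
    (h1 : ∀ n, fderiv ℝ G₀ (x n) = fderiv ℝ G₀ x₀)
    (h2 : ∀ n, fderiv ℝ (fderiv ℝ G₀) (x n) = fderiv ℝ (fderiv ℝ G₀) x₀)
    (hR : ∀ n (X Y : E), riemAt G₀ (x n) X Y = riemAt G₀ x₀ X Y)
    (hd0 : Tendsto (fun n ↦ ‖G (x n) - G₀ (x n)‖) l (𝓝 0))
    (hd1 : Tendsto (fun n ↦ ‖fderiv ℝ G (x n) - fderiv ℝ G₀ (x n)‖) l (𝓝 0))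
    (hd2 : Tendsto (fun n ↦ ‖fderiv ℝ (fderiv ℝ G) (x n) - fderiv ℝ (fderiv ℝ G₀) (x n)‖) l (𝓝 0)) :
    Tendsto (fun n ↦ ∑ a, ∑ a', ∑ c, ∑ c', ginv G b (x n) a a' * ginv G b (x n) c c' *
        traceCLM E ((riemAt G (x n) (b a) (b c)).comp (riemAt G (x n) (b a') (b c')))) l
      (𝓝 (∑ a, ∑ a', ∑ c, ∑ c', ginv G₀ b x₀ a a' * ginv G₀ b x₀ c c' *
        traceCLM E ((riemAt G₀ x₀ (b a) (b c)).comp (riemAt G₀ x₀ (b a') (b c'))))) := by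
  have hgi := tendsto_ginv_of_jets b hG hG₀ hx h0 hd0
  have hRi := tendsto_riemAt_of_jets hG hG₀ hx h0 h1 h2 hR hd0 hd1 hd2
  refine tendsto_finsetSum _ fun a _ ↦ tendsto_finsetSum _ fun a' _ ↦
    tendsto_finsetSum _ fun c _ ↦ tendsto_finsetSum _ fun c' _ ↦ ?_
  exact ((hgi a a').mul (hgi c c')).mul
    (((traceCLM E).continuous.tendsto _).comp (tendsto_clm_comp (hRi (b a) (b c)) (hRi (b a') (b c'))))

/-- **The cubic trace invariant converges** along the points `x n`:
`Σ g^{aa'}g^{cc'}g^{ee'} tr(R(b_a,b_c) R(b_{c'},b_e) R(b_{e'},b_{a'}))` of `G` at `x n` tends to that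
of `G₀` at `x₀`. [cite: Kotschwar2014, §1.1 (8)] -/
theorem tendsto_cubicTrace_of_jets (hG : ∀ n, IsMetricOn G (V n)) (hG₀ : ∀ n, IsMetricOn G₀ (V n))
    (hx : ∀ n, x n ∈ V n) (h0 : ∀ n, G₀ (x n) = G₀ x₀)
    (h1 : ∀ n, fderiv ℝ G₀ (x n) = fderiv ℝ G₀ x₀)
    (h2 : ∀ n, fderiv ℝ (fderiv ℝ G₀) (x n) = fderiv ℝ (fderiv ℝ G₀) x₀)
    (hR : ∀ n (X Y : E), riemAt G₀ (x n) X Y = riemAt G₀ x₀ X Y)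
    (hd0 : Tendsto (fun n ↦ ‖G (x n) - G₀ (x n)‖) l (𝓝 0))
    (hd1 : Tendsto (fun n ↦ ‖fderiv ℝ G (x n) - fderiv ℝ G₀ (x n)‖) l (𝓝 0))
    (hd2 : Tendsto (fun n ↦ ‖fderiv ℝ (fderiv ℝ G) (x n) - fderiv ℝ (fderiv ℝ G₀) (x n)‖) l (𝓝 0)) :
    Tendsto (fun n ↦ ∑ a, ∑ a', ∑ c, ∑ c', ∑ e, ∑ e',
        ginv G b (x n) a a' * ginv G b (x n) c c' * ginv G b (x n) e e' *
        traceCLM E ((riemAt G (x n) (b a) (b c)).comp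
          ((riemAt G (x n) (b c') (b e)).comp (riemAt G (x n) (b e') (b a'))))) l
      (𝓝 (∑ a, ∑ a', ∑ c, ∑ c', ∑ e, ∑ e',
        ginv G₀ b x₀ a a' * ginv G₀ b x₀ c c' * ginv G₀ b x₀ e e' *
        traceCLM E ((riemAt G₀ x₀ (b a) (b c)).comp
          ((riemAt G₀ x₀ (b c') (b e)).comp (riemAt G₀ x₀ (b e') (b a')))))) := by
  have hgi := tendsto_ginv_of_jets b hG hG₀ hx h0 hd0
  have hRi := tendsto_riemAt_of_jets hG hG₀ hx h0 h1 h2 hR hd0 hd1 hd2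
  refine tendsto_finsetSum _ fun a _ ↦ tendsto_finsetSum _ fun a' _ ↦
    tendsto_finsetSum _ fun c _ ↦ tendsto_finsetSum _ fun c' _ ↦
    tendsto_finsetSum _ fun e _ ↦ tendsto_finsetSum _ fun e' _ ↦ ?_
  exact (((hgi a a').mul (hgi c c')).mul (hgi e e')).mul
    (((traceCLM E).continuous.tendsto _).comp (tendsto_clm_comp (hRi (b a) (b c))
      (tendsto_clm_comp (hRi (b c') (b e)) (hRi (b e') (b a')))))

end Jets


end JetConvergence

end MetricCoord

end Literature.Geometry.Lorentzian

end
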